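import Summits.QuantumFields.BalabanUV.Beta.FP.QstepSymBlockTranslate

/-!
# `BalabanUV.Beta.FP.TorusReferenceBlock` — road «FP», binder row D1, ROUTE T (β1), STUB P of the row's ONE file, (C) part 6 (J-NOTE-20 §8's instance; SPEC-64 §14 (3)):
# **THE REFERENCE TORUS `M′ = fun _ => Lc` (ONE BIG BLOCK): the translated site ∕ bond lands in its box, and `treeGauge_readout_corr_sym` SPECIALISED to it** — the socket of the
# row's (P-c) with the reference-torus bookkeeping done

WHAT ([folklore] floor-division bookkeeping + one specialisation BY NAME; no `def`, no `def … : Prop`, nothing cited, 0 sorry, default heartbeats).  With `L := bigRatio Lc (n+1)` and the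
reference top torus `M₁ := fun _ => Lc` (`Lc ∣ Lc`; its tower's finest torus is `fun _ => L` pointwise — `towerTorus_ref_apply`): §1 `sub_zsmul_quo_mem_pbox_ref` (`x − L • quo L x ∈ pbox (towerTorus Lc M₁ (n+1))`
for EVERY lattice point `x` — the representative of `x` in its own big block, moved to the block `0`), `mem_pbox_ref_of_quo_eq` (a point of the big block `c` moved by `−L•c` lands in the reference box);
§2 **`treeGauge_readout_eq_reference`**: `FP/QstepSymBlockTranslate.treeGauge_readout_corr_sym` at `M′ := M₁`, `v := −quo L ↑s`, `s′ := ↑s − L • quo L ↑s`: under the wrapper's letters on the box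
`M` AND on the reference torus (primed: `hQ₁₀′ … hE′`, G-2's `det ≠ 0` there, the (D)-shaped equation there) and the column agreement «`X b = X′ b′` whenever `↑b′.1 = ↑b.1 − L • quo L ↑s`,
`b′.2 = b.2` and both endpoints of `b` lie in `s`'s big block», the `hlve` word of `(M, θ, s)` equals the `hlve` word of the reference torus at the representative site.  The row's (P-c)
DEFINES `λℤ` by the right-hand side (reference objects are `B`-free) and is left with the column bookkeeping (PART 47∕52 unwrapping) and G-2 ∕ (D) on the reference torus.
WHAT THIS IS NOT: (P-c) itself; `hlve` NOT instantiated; nothing of Bałaban's asserted, valued or discharged; 0 estimates; 0∕4 row-D1 binders (hW, hR, D1Tel, D1Rep); ROOT M‴ p325680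
untouched; NOT (C1), NOT (L2′), NOT (T-ID), NOT SDF, NOT D1, NEVER «G-an2-4 closed», NOT BetaPertH, NOT continuum, NOT Clay.

HONEST DEPENDENCY (page 1, mandatory): continuum YM on T⁴ ⇐ BetaPertH ∧ nine spine estimates (0/9 proved); BetaPertH ⇐ (D1) ∧ (D4) ∧ CAP+tail;
G-an2-4 gates asym, D1 and NE2/3/4.  HONEST FRAMING (cell contract, verbatim): «discharging `BetaPertH` makes Bałaban's UV stability UNCONDITIONAL —
a real constructive-QFT result; it is NOT the continuum limit and NOT the Clay problem.»  ABSOLUTE RULE (cell charter, verbatim): «No internally-minted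
statement may enter as a cited fact. Every hypothesis is either kernel-proved in this package or a verbatim quotation of a PUBLISHED theorem with page
reference. The manuscript(s) under audit are NOT citable for their own disputed steps — they are the thing under adjudication; programme-internal
(2001/route/tribunal) claims are never citable.»  Road «FP» OWNER, b2b-balaban-beta-d1-p3 gen 54, 2026-08-29.  No existing file touched.
-/

noncomputable section

namespace Summit.QuantumFields.BalabanUV.Beta.FP.TorusReferenceBlock

open Matrix Finset
open scoped BigOperators
open Literature.MathematicalPhysics.QuantumFieldTheory
open Literature.MathematicalPhysics.QuantumFieldTheory.Balaban1983to89
open Literature.MathematicalPhysics.QuantumFieldTheory.Balaban1983to89.Beta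
open B5Prop11Plancherel (fine)
open B6Lemma24Torus (pbox mem_pbox)
open AffineAveraging (Site toSite unitVec)
open OneStepResolventKernel (Fib)
open Literature.MathematicalPhysics.QuantumFieldTheory.LatticeForm (quo)
open Summit.QuantumFields.BalabanUV.Beta.FP.TorusCombForest (block_bounds)
open Summit.QuantumFields.BalabanUV.Beta.FP.TorusCombRows (Res)
open Summit.QuantumFields.BalabanUV.Beta.FP.TorusCompositeObjects
open Summit.QuantumFields.BalabanUV.Beta.FP.TorusCompositeObjectsG (compRowsSym)
open Summit.QuantumFields.BalabanUV.Beta.FP.TorusCompositeUnimodular (towerEvalC)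
open Summit.QuantumFields.BalabanUV.Beta.FP.QstepSymBlockTranslate (treeGauge_readout_corr_sym)

variable {d : ℕ}

/-! ## §1 The reference tower's finest torus; representatives land in its box -/

section Ref

variable (Lc : ℕ) [NeZero Lc]

omit [NeZero Lc] in
/-- [folklore] the finest torus of the reference tower over `fun _ => Lc` has all moduli `bigRatio Lc (n+1) = Lc^(n+2)`. -/
theorem towerTorus_ref_apply (n : ℕ) (i : Fin (d + 1)) : towerTorus Lc (fun _ : Fin (d + 1) => Lc) (n + 1) i = bigRatio Lc (n + 1) := by
  rw [towerTorus_apply, bigRatio_eq_pow]; ring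

/-- [folklore] **THE REPRESENTATIVE OF A LATTICE POINT IN ITS OWN BIG BLOCK, MOVED TO THE BLOCK `0`, LIES IN THE REFERENCE BOX**: `x − L • quo L x ∈ pbox (towerTorus Lc (fun _ => Lc) (n+1))`. -/
theorem sub_zsmul_quo_mem_pbox_ref (n : ℕ) (x : Site (d + 1)) :
    x + ((bigRatio Lc (n + 1) : ℕ) : ℤ) • (-quo (bigRatio Lc (n + 1)) x) ∈ pbox (towerTorus Lc (fun _ : Fin (d + 1) => Lc) (n + 1)) := by
  have hL : 0 < bigRatio Lc (n + 1) := bigRatio_pos Lc (Nat.pos_of_ne_zero (NeZero.ne Lc)) (n + 1)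
  rw [mem_pbox]
  intro i
  rw [towerTorus_ref_apply]
  have hb := block_bounds (d := d) hL x i
  have hq : quo (bigRatio Lc (n + 1)) x i = x i / ((bigRatio Lc (n + 1) : ℕ) : ℤ) := rfl
  simp only [Pi.add_apply, Pi.smul_apply, Pi.neg_apply, smul_eq_mul, mul_neg, hq]
  constructor
  · linarith [hb.1]
  · linarith [hb.2]

/-- [folklore] **A POINT OF THE BIG BLOCK `c`, MOVED BY `−L•c`, LANDS IN THE REFERENCE BOX.** -/
theorem mem_pbox_ref_of_quo_eq (n : ℕ) {x c : Site (d + 1)} (hx : quo (bigRatio Lc (n + 1)) x = c) :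
    x + ((bigRatio Lc (n + 1) : ℕ) : ℤ) • (-c) ∈ pbox (towerTorus Lc (fun _ : Fin (d + 1) => Lc) (n + 1)) := by
  rw [← hx]; exact sub_zsmul_quo_mem_pbox_ref Lc n x

end Ref

/-! ## §2 `treeGauge_readout_corr_sym` specialised to the reference torus -/

section Reference

variable (Lc : ℕ) [NeZero Lc] (M : Fin (d + 1) → ℕ) [∀ μ, NeZero (M μ)] (lev : ℕ → ℕ) (rs : ℕ → (Fin (d + 1) → ℕ))
  (hrs : ∀ k i, 0 ≤ toSite (rs k) i ∧ toSite (rs k) i < (Lc : ℤ)) (hM : ∀ i, Lc ∣ M i) (n : ℕ)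
include hM

/-- **THE `hlve` WORD ON THE BOX `M` AT THE FINEST SITE `s` EQUALS THE `hlve` WORD OF THE REFERENCE TORUS `fun _ => Lc` AT THE REPRESENTATIVE `↑s − L • quo L ↑s`**, provided the two
one-shot chart columns agree on corresponding bonds inside `s`'s big block (the representative's block is the whole reference box) — `treeGauge_readout_corr_sym` at `M′ := fun _ => Lc`,
`v := −quo L ↑s`; the wrapper's letters are displayed on BOTH towers (primed = reference), G-2's `det ≠ 0` and the (D)-shaped equation on both. -/
theorem treeGauge_readout_eq_reference
    {Q₁₀ : Matrix (↥(pbox M) × Fin (d + 1)) (↥(pbox (towerTorus Lc M (n + 1))) × Fin (d + 1)) ℝ} (hQ₁₀ : Q₁₀ = compRowsSym Lc M lev rs (n + 1))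
    {τ₁ : Matrix (NParam Lc (fine Lc M) (fun k => rs (k + 1)) n) (↥(pbox (towerTorus Lc M (n + 1))) × Fin (d + 1)) ℝ}
    (hτ₁ : τ₁ = bigP Lc (fine Lc M) (fun k => rs (k + 1)) (fun k => hrs (k + 1)) n)
    {τ₂ : Matrix (Res (toSite (rs 0)) Lc M) (↥(pbox M) × Fin (d + 1)) ℝ} (hτ₂ : τ₂ = combF Lc M (rs 0))
    {N : Matrix (NParam Lc M rs (n + 1)) (↥(pbox (towerTorus Lc M (n + 1))) × Fin (d + 1)) ℝ} (hN : N = Matrix.fromRows (τ₂ * Q₁₀) τ₁)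
    {W₀ : Matrix (↥(pbox (towerTorus Lc M (n + 1))) × Fin (d + 1)) (NParam Lc M rs (n + 1)) ℝ} (hW₀ : W₀ = towerGen Lc M rs (n + 1))
    {E : Matrix (NParam Lc M rs (n + 1)) (NParam Lc M rs (n + 1)) ℝ} (hE : E = towerEvalC Lc M rs hrs (n + 1))
    {Q₁₀' : Matrix (↥(pbox (fun _ : Fin (d + 1) => Lc)) × Fin (d + 1)) (↥(pbox (towerTorus Lc (fun _ : Fin (d + 1) => Lc) (n + 1))) × Fin (d + 1)) ℝ}
    (hQ₁₀' : Q₁₀' = compRowsSym Lc (fun _ : Fin (d + 1) => Lc) lev rs (n + 1))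
    {τ₁' : Matrix (NParam Lc (fine Lc (fun _ : Fin (d + 1) => Lc)) (fun k => rs (k + 1)) n) (↥(pbox (towerTorus Lc (fun _ : Fin (d + 1) => Lc) (n + 1))) × Fin (d + 1)) ℝ}
    (hτ₁' : τ₁' = bigP Lc (fine Lc (fun _ : Fin (d + 1) => Lc)) (fun k => rs (k + 1)) (fun k => hrs (k + 1)) n)
    {τ₂' : Matrix (Res (toSite (rs 0)) Lc (fun _ : Fin (d + 1) => Lc)) (↥(pbox (fun _ : Fin (d + 1) => Lc)) × Fin (d + 1)) ℝ}
    (hτ₂' : τ₂' = combF Lc (fun _ : Fin (d + 1) => Lc) (rs 0))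
    {N' : Matrix (NParam Lc (fun _ : Fin (d + 1) => Lc) rs (n + 1)) (↥(pbox (towerTorus Lc (fun _ : Fin (d + 1) => Lc) (n + 1))) × Fin (d + 1)) ℝ}
    (hN' : N' = Matrix.fromRows (τ₂' * Q₁₀') τ₁')
    {W₀' : Matrix (↥(pbox (towerTorus Lc (fun _ : Fin (d + 1) => Lc) (n + 1))) × Fin (d + 1)) (NParam Lc (fun _ : Fin (d + 1) => Lc) rs (n + 1)) ℝ}
    (hW₀' : W₀' = towerGen Lc (fun _ : Fin (d + 1) => Lc) rs (n + 1))
    {E' : Matrix (NParam Lc (fun _ : Fin (d + 1) => Lc) rs (n + 1)) (NParam Lc (fun _ : Fin (d + 1) => Lc) rs (n + 1)) ℝ}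
    (hE' : E' = towerEvalC Lc (fun _ : Fin (d + 1) => Lc) rs hrs (n + 1))
    (hTW : (N * W₀).det ≠ 0) (hTW' : (N' * W₀').det ≠ 0)
    {θ : NParam Lc M rs (n + 1) → ℝ} {θ' : NParam Lc (fun _ : Fin (d + 1) => Lc) rs (n + 1) → ℝ}
    {X : ↥(pbox (towerTorus Lc M (n + 1))) × Fin (d + 1) → ℝ} {X' : ↥(pbox (towerTorus Lc (fun _ : Fin (d + 1) => Lc) (n + 1))) × Fin (d + 1) → ℝ}
    (hθ : (N * W₀) *ᵥ θ = -(N *ᵥ X)) (hθ' : (N' * W₀') *ᵥ θ' = -(N' *ᵥ X'))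
    (s : ↥(pbox (towerTorus Lc M (n + 1))))
    (hX : ∀ (b : ↥(pbox (towerTorus Lc M (n + 1))) × Fin (d + 1)) (b' : ↥(pbox (towerTorus Lc (fun _ : Fin (d + 1) => Lc) (n + 1))) × Fin (d + 1)),
      (b'.1 : Site (d + 1)) = (b.1 : Site (d + 1)) + ((bigRatio Lc (n + 1) : ℕ) : ℤ) • (-quo (bigRatio Lc (n + 1)) (s : Site (d + 1))) → b'.2 = b.2 →
      quo (bigRatio Lc (n + 1)) (b.1 : Site (d + 1)) = quo (bigRatio Lc (n + 1)) (s : Site (d + 1)) →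
      quo (bigRatio Lc (n + 1)) ((b.1 : Site (d + 1)) + unitVec b.2) = quo (bigRatio Lc (n + 1)) (s : Site (d + 1)) → X b = X' b') :
    (∑ x : Res (bigRoot Lc rs (n + 1)) (bigRatio Lc (n + 1)) (towerTorus Lc M (n + 1)),
        (if (x.1 : ↥(pbox (towerTorus Lc M (n + 1)))) = s then (E *ᵥ θ) (towerEquiv Lc M rs hrs (n + 1) x) else 0))
      = ∑ x' : Res (bigRoot Lc rs (n + 1)) (bigRatio Lc (n + 1)) (towerTorus Lc (fun _ : Fin (d + 1) => Lc) (n + 1)),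
        (if (x'.1 : ↥(pbox (towerTorus Lc (fun _ : Fin (d + 1) => Lc) (n + 1))))
            = ⟨(s : Site (d + 1)) + ((bigRatio Lc (n + 1) : ℕ) : ℤ) • (-quo (bigRatio Lc (n + 1)) (s : Site (d + 1))), sub_zsmul_quo_mem_pbox_ref Lc n (s : Site (d + 1))⟩
          then (E' *ᵥ θ') (towerEquiv Lc (fun _ : Fin (d + 1) => Lc) rs hrs (n + 1) x') else 0) :=
  treeGauge_readout_corr_sym Lc M (fun _ : Fin (d + 1) => Lc) lev rs hrs hM (fun _ => dvd_rfl) n (-quo (bigRatio Lc (n + 1)) (s : Site (d + 1)))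
    hQ₁₀ hτ₁ hτ₂ hN hW₀ hE hQ₁₀' hτ₁' hτ₂' hN' hW₀' hE' hTW hTW' hθ hθ' s _ rfl hX

end Reference

end Summit.QuantumFields.BalabanUV.Beta.FP.TorusReferenceBlock

end
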